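import Summits.QuantumFields.YangMills.Theorems.UnitScaleTiltProp7BlendPrescribed
import Literature.MathematicalPhysics.QuantumFieldTheory.Balaban1983to89.T3UnitLawGaugeInvariance
import HarnessLib

/-!
# Route `UnitScaleTilt`, crux K1 child «MinimiserStabilityRegPr» (stmt-QuantumFields-19200) — RE-GAUGING A Σ-TWISTED REPRESENTATIVE ONTO THE UNTWISTED FIBRE:
# if `X^u ∈ (6)(e) ∩ 𝔅_k(V)` then `X^g ∈ (6)(e) ∩ 𝔅_k(V)` for EVERY `g` with the same centre values `g↓ = u↓`; with the prescribed-centre blend, an untwisted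
# representative with the pointwise bound `‖(X^g)_b·U₀,b⁻¹ − 1‖ ≤ 1600·L^{−(K−n)}·D(b) + 4096·ρ(b)` on every bond

Cell `ym3-torus` ∕ fleet seat `ym-ust-19200-p1` (gen 14, route-R lead ∕ (n3) namer).  THEOREMS ONLY (0 `def`, 0 `sorry`); `--supports stmt-QuantumFields-19200`, count-neutral.
YM₃ on T³ is a ladder rung (R3), not the Clay problem; nothing here claims the stub, the crux, d = 4 or the mass gap.

WHY (CARD-19200-V3-g14 §3, option (U2)).  Print's Landau representative `X = e^{iηA}W` of a competitor `W′ = X^u ∈ 𝔅_k(V)` lies on the Σ-twisted fibre `𝔅_k(V^{(u↓)⁻¹})`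
(✓`T3PrintedRegularOrbits.gaugeAct_mem_regFibrePr_iff`), `u↓ = descTransf u` its centre values ([Balaban1985RegularSpaces] p.81 l.13).  The growth-side rows of record want an
UNTWISTED representative `e^{iD}W ∈ 𝔅_k(V)`.  Since the fibres are permuted by the centre values alone, ANY gauge transformation `g` with `g(embIter y) = u(embIter y)` at every
`(K−n)`-centre carries `X` back: `X^g ∈ (6)(e) ∩ 𝔅_k(V)` (§1: `X^g = (X^u)^{g·u⁻¹}`, `(g·u⁻¹)↓ = 1`, ✓`gaugeAct_mem_regFibrePr_iff_of_trivial`).  The trilinear geodesic blend with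
prescribed centre values (✓`Prop7BlendPrescribed.exists_blend_of_corners_T3`) supplies such a `g` together with the pointwise bound of its bond variables against any background
`U₀` from the cell data of the corner gauges (§2).

WHAT IS PROVED (ns `…Theorems.Prop7TwistRegauge`; T³, `SU(2)`).
* §1 `descTransf_eq_of_centre_eq` (equal centre values ⇒ equal descended gauges), `gaugeAct_eq_gaugeAct_mul_inv` (`X^g = (X^u)^{g·u⁻¹}`), ★ `gaugeAct_mem_fibre_of_centre_eq`,
  ★ `gaugeAct_mem_regFibrePr_of_centre_eq` (`X^u ∈ (6)(e) ∩ 𝔅_k(V)`, `g↓ = u↓` ⟹ `X^g ∈ (6)(e) ∩ 𝔅_k(V)`).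
* §2 ★★ `exists_untwistedRegauge_T3` — corner gauges `vE x y ∈ SU(2)` WITH `vE (embIter y) y = u(embIter y)` and gen 9's cell data ⟹ `∃ g`, `X^g ∈ (6)(e) ∩ 𝔅_k(V)` and
  `‖pertVar U₀ (X^g) ⟨z,μ⟩‖ ≤ 1600·L^{−(K−n)}·D(z,μ) + 4096·ρ(z,μ)` on every bond.
HONEST SCOPE.  Bookkeeping over landed letters; the CORNER DATA for print's twisted representative (W-comb transports of `u↓`, cell closeness from the twist, thin-rectangle
Stokes) and the `ℓ²`∕divergence bookkeeping of the blend are NOT here.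

References: T. Bałaban, CMP 102 (1985) 277–309 [Balaban1985Variational] ((3)–(4), (6) p.278, (18) p.280); CMP 99 (1985) 75–102 [Balaban1985RegularSpaces]
((1.29)–(1.30) p.81); CMP 98 (1985) 17–51 [Balaban1985Averaging] ((11)–(13) p.19).
-/

noncomputable section

open scoped Matrix.Norms.L2Operator

namespace Summit.QuantumFields.YangMills.Theorems.Prop7TwistRegauge

open Literature.MathematicalPhysics.QuantumFieldTheory.Balaban1983to89
open T4Continuum BlockAveraging
open B10Eq27TorusAxialLog (transl)
open B7Prop1Explicit renaming Site → LSite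
open B5Eq118OneStroke (iterBlockOf)
open B15DeterminingSets (embIter)
open Literature.MathematicalPhysics.QuantumFieldTheory.Balaban1983to89.T3ContinuumYM3Torus
open Literature.MathematicalPhysics.QuantumFieldTheory.Balaban1983to89.T3UnitLawDensityEML (ℰp)
open Literature.MathematicalPhysics.QuantumFieldTheory.Balaban1983to89.T3ConstrainedMinimiser (fibre)
open Literature.MathematicalPhysics.QuantumFieldTheory.Balaban1983to89.T3PrintedRegularMinimiser (RegPr regFibrePr mem_regFibrePr_iff)
open Literature.MathematicalPhysics.QuantumFieldTheory.Balaban1983to89.T3PrintedRegularOrbits (descTransf gaugeAct_mem_fibre_iff_of_trivial gaugeAct_mem_regFibrePr_iff_of_trivial)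
open Literature.MathematicalPhysics.QuantumFieldTheory.Balaban1983to89.T3UnitLawGaugeInvariance (gaugeAct_gaugeAct)
open BlockAveragingEMLLinearisedBackground (pertVar)
open Summit.QuantumFields.YangMills.Theorems.Prop7FlatHolonomy (transfUp_eq_embIter)
open Summit.QuantumFields.YangMills.Theorems.Prop7BlendPrescribed (exists_blend_of_corners_T3)

section T3

variable (F : T3Family) {n K : ℕ} (h : n ≤ K)

/-! ## §1 Equal centre values carry the twisted representative back to the untwisted fibre -/

/-- Two gauge transformations with the same values at the `(K−n)`-centres descend to the same gauge transformation of the comparison lattice.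
[cite: Balaban1985Averaging, (12)-(13) p.19] -/
theorem descTransf_eq_of_centre_eq {G : Type*} [GaugeGroup G] {g u : GaugeTransf (F.P K) 0 G}
    (hc : ∀ y : Site (F.P K) (K - n), g (embIter (K - n) y) = u (embIter (K - n) y)) :
    descTransf F n K h g = descTransf F n K h u := by
  funext x
  unfold descTransf
  rw [transfUp_eq_embIter, transfUp_eq_embIter]
  exact hc _

/-- `X^g = (X^u)^{g·u⁻¹}` (composition of gauge actions). [cite: Balaban1985Averaging, (11) p.19] -/
theorem gaugeAct_eq_gaugeAct_mul_inv {G : Type*} [GaugeGroup G] (g u : GaugeTransf (F.P K) 0 G) (X : GaugeField (F.P K) 0 G) :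
    GaugeField.gaugeAct g X = GaugeField.gaugeAct (fun x => g x * (u x)⁻¹) (GaugeField.gaugeAct u X) := by
  rw [gaugeAct_gaugeAct]
  congr 1
  funext x
  rw [mul_assoc, inv_mul_cancel, mul_one]

/-- `(g·u⁻¹)↓ = 1` when `g` and `u` agree at the centres. [cite: Balaban1985Averaging, (12)-(13) p.19] -/
theorem descTransf_mul_inv_eq_one {G : Type*} [GaugeGroup G] {g u : GaugeTransf (F.P K) 0 G}
    (hc : ∀ y : Site (F.P K) (K - n), g (embIter (K - n) y) = u (embIter (K - n) y)) :
    descTransf F n K h (fun x => g x * (u x)⁻¹) = fun _ => 1 := by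
  funext x
  unfold descTransf
  rw [transfUp_eq_embIter, hc, mul_inv_cancel]

/-- ★ **THE FIBRE DEPENDS ON THE CENTRE VALUES ONLY**: `X^u ∈ 𝔅_k(V)` and `g(embIter y) = u(embIter y)` for every centre ⟹ `X^g ∈ 𝔅_k(V)`.
[cite: Balaban1985Variational, (3)-(4) p.278; Balaban1985Averaging, (11) p.19] -/
theorem gaugeAct_mem_fibre_of_centre_eq {G : Type*} [GaugeGroup G] (ℰ : LoopAverage G) {g u : GaugeTransf (F.P K) 0 G}
    (hc : ∀ y : Site (F.P K) (K - n), g (embIter (K - n) y) = u (embIter (K - n) y))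
    {X : GaugeField (F.P K) 0 G} {V : GaugeField (F.P n) 0 G} (hXu : GaugeField.gaugeAct u X ∈ fibre F ℰ n K h V) :
    GaugeField.gaugeAct g X ∈ fibre F ℰ n K h V := by
  rw [gaugeAct_eq_gaugeAct_mul_inv F g u X]
  exact (gaugeAct_mem_fibre_iff_of_trivial F h ℰ (descTransf_mul_inv_eq_one F h hc) _ V).mpr hXu

/-- ★ **PRINT'S REGULAR FIBRE (6)(e) LIKEWISE**: `X^u ∈ (6)(e) ∩ 𝔅_k(V)` and `g(embIter y) = u(embIter y)` for every centre ⟹ `X^g ∈ (6)(e) ∩ 𝔅_k(V)` (`e ≥ 0`).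
[cite: Balaban1985Variational, (6) p.278; Balaban1985RegularSpaces, (1.29)-(1.30) p.81] -/
theorem gaugeAct_mem_regFibrePr_of_centre_eq {e : ℝ} (he : 0 ≤ e) {g u : GaugeTransf (F.P K) 0 (Matrix.specialUnitaryGroup (Fin 2) ℂ)}
    (hc : ∀ y : Site (F.P K) (K - n), g (embIter (K - n) y) = u (embIter (K - n) y))
    {X : GaugeField (F.P K) 0 (Matrix.specialUnitaryGroup (Fin 2) ℂ)} {V : GaugeField (F.P n) 0 (Matrix.specialUnitaryGroup (Fin 2) ℂ)}
    (hXu : GaugeField.gaugeAct u X ∈ regFibrePr F n K h e V) :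
    GaugeField.gaugeAct g X ∈ regFibrePr F n K h e V := by
  rw [gaugeAct_eq_gaugeAct_mul_inv F g u X]
  exact (gaugeAct_mem_regFibrePr_iff_of_trivial F h he (descTransf_mul_inv_eq_one F h hc) _ V).mpr hXu

/-! ## §2 The untwisted representative from the prescribed-centre blend -/

/-- ★★ **RE-GAUGING A TWISTED REPRESENTATIVE ONTO THE UNTWISTED FIBRE WITH A POINTWISE BOUND.**  `L ≥ 7`; `X, U₀` any `SU(2)` fields on the finest torus of a member;
`X^u ∈ (6)(e) ∩ 𝔅_k(V)` (`e ≥ 0`); `off` a uniform centre offset; corner gauges `vE x y ∈ SU(2)` whose value at the centre of `y` is `u(embIter y)`, with gen 9's cell data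
(the eight `vE z (c(z)+ε)` pairwise `D(z,μ)`-close at `z` and at `z + e_μ`, `D ≤ 1∕1600`; `‖vE z (c(z)+ε)·X_b·vE (z+e_μ) (c(z)+ε)*·U₀,b* − 1‖ ≤ ρ(z,μ) ≤ 1∕4096`).  Then there is
a gauge transformation `g` with `X^g ∈ (6)(e) ∩ 𝔅_k(V)` (UNTWISTED) and `‖pertVar U₀ (X^g) ⟨z,μ⟩‖ ≤ 1600·L^{−(K−n)}·D(z,μ) + 4096·ρ(z,μ)` on EVERY bond.
[cite: Balaban1985Variational, (4) p.278, (6) p.278, (18) p.280; Balaban1985RegularSpaces, (1.29)-(1.30) p.81, Lemma 1 p.79] -/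
theorem exists_untwistedRegauge_T3 (hL : 7 ≤ F.L) {e : ℝ} (he : 0 ≤ e)
    {V : GaugeField (F.P n) 0 (Matrix.specialUnitaryGroup (Fin 2) ℂ)} (U₀ X : GaugeField (F.P K) 0 (Matrix.specialUnitaryGroup (Fin 2) ℂ))
    (u : GaugeTransf (F.P K) 0 (Matrix.specialUnitaryGroup (Fin 2) ℂ)) (hXu : GaugeField.gaugeAct u X ∈ regFibrePr F n K h e V) {off : ℕ}
    (hoff : ∀ (y : Site (F.P K) (K - n)) (μ : Fin (F.P K).d), ((embIter (K - n) y) μ).val = (y μ).val * (F.P K).L ^ (K - n) + off)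
    (vE : Site (F.P K) 0 → Site (F.P K) (K - n) → Matrix (Fin 2) (Fin 2) ℂ)
    (hSU : ∀ x y, vE x y ∈ Matrix.specialUnitaryGroup (Fin 2) ℂ)
    (hcentre : ∀ y, vE (embIter (K - n) y) y = ((u (embIter (K - n) y) : Matrix.specialUnitaryGroup (Fin 2) ℂ) : Matrix (Fin 2) (Fin 2) ℂ))
    (D ρ : Site (F.P K) 0 → Fin (F.P K).d → ℝ) (hD : ∀ z μ, D z μ ≤ 1 / 1600) (hρ : ∀ z μ, ρ z μ ≤ 1 / 4096)
    (hvv : ∀ (z : Site (F.P K) 0) (μ : Fin (F.P K).d) (ε ε' : LSite (F.P K).d), (∀ ν, ε ν = 0 ∨ ε ν = 1) → (∀ ν, ε' ν = 0 ∨ ε' ν = 1) →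
      ‖vE z (transl (iterBlockOf (K - n) (transl z (fun _ => -(off : ℤ)))) ε) *
          star (vE z (transl (iterBlockOf (K - n) (transl z (fun _ => -(off : ℤ)))) ε')) - 1‖ ≤ D z μ ∧
      ‖vE (z.shift μ) (transl (iterBlockOf (K - n) (transl z (fun _ => -(off : ℤ)))) ε) *
          star (vE (z.shift μ) (transl (iterBlockOf (K - n) (transl z (fun _ => -(off : ℤ)))) ε')) - 1‖ ≤ D z μ)
    (htr : ∀ (z : Site (F.P K) 0) (μ : Fin (F.P K).d) (ε : LSite (F.P K).d), (∀ ν, ε ν = 0 ∨ ε ν = 1) →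
      ‖vE z (transl (iterBlockOf (K - n) (transl z (fun _ => -(off : ℤ)))) ε) *
          ((X ⟨z, μ⟩ : Matrix.specialUnitaryGroup (Fin 2) ℂ) : Matrix (Fin 2) (Fin 2) ℂ) *
          star (vE (z.shift μ) (transl (iterBlockOf (K - n) (transl z (fun _ => -(off : ℤ)))) ε)) *
          star ((U₀ ⟨z, μ⟩ : Matrix.specialUnitaryGroup (Fin 2) ℂ) : Matrix (Fin 2) (Fin 2) ℂ) - 1‖ ≤ ρ z μ) :
    ∃ g : GaugeTransf (F.P K) 0 (Matrix.specialUnitaryGroup (Fin 2) ℂ),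
      GaugeField.gaugeAct g X ∈ regFibrePr F n K h e V ∧
      ∀ (z : Site (F.P K) 0) (μ : Fin (F.P K).d),
        ‖pertVar U₀ (GaugeField.gaugeAct g X) ⟨z, μ⟩‖ ≤ 1600 * (((F.L : ℝ))⁻¹) ^ (K - n) * D z μ + 4096 * ρ z μ := by
  obtain ⟨g, hg, hbound⟩ := exists_blend_of_corners_T3 F hL U₀ X hoff vE hSU D ρ hD hρ hvv htr
  refine ⟨g, gaugeAct_mem_regFibrePr_of_centre_eq F h he (fun y => Subtype.ext ((hg y).trans (hcentre y))) hXu, hbound⟩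

end T3

end Summit.QuantumFields.YangMills.Theorems.Prop7TwistRegauge

end
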